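import Summits.BirchSwinnertonDyer.BirchSwinnertonDyer.Theorems.TameQuarticSolventSolventPairLowerBoundPairGivenGoodFieldOfSolventPackage
import Summits.BirchSwinnertonDyer.BirchSwinnertonDyer.Theorems.TameQuarticSolventSolventPairLowerBoundSolventFieldReal
import HarnessLib

/-!
# Route `TameQuarticSolvent`, crux `SolventPairLowerBound` (stmt-BirchSwinnertonDyer-21391), line `birth` —
# stub `stub_pairGivenGoodField` ⇐ K1 ∧ K2(a): the solvent field is CONSTRUCTED (sibling rungs
# `…SolventField`, `…SolventFieldReal`), the bookkeeping is DISCHARGED (`…PairGivenGoodFieldOfSolventPackage`),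
# and exactly two load-bearing hypotheses remain, displayed in closed form

HONEST FRAMING. Theorems only; helper towards the registered stub `stub_pairGivenGoodField` of the birth skeleton
(`--supports stmt-BirchSwinnertonDyer-21391`, width seat `bsd-wall-tqs-p1-w2`). The two remaining inputs are
HYPOTHESES written out in full (no definition is minted; a prover files no statement items — the planner
decides whether their universal closures become the children `ExactBSD3OverSolvent` / `KolyvaginTwistedUpper`
of the stub):
* **K1** (`hK1`, exact `BSD₃` over the tame quartic — OPEN, conjecture-level): for `W` on the leaf, every
  `d > 0` with `ord₃ d = 1`, every quadratic field `K = ℚ(θ₁)`, `θ₁² = d`, every TOTALLY POSITIVE `β ∈ K` of ODD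
  valuation at the places above `3`, and every quadratic `M = K(θ)`, `θ² = β`, which is totally real with
  `e(w ∣ 3) = 4` and `W_M` of GOOD reduction at every `w ∣ 3`: `BSDpOver VM 3` for every model `VM ≅ W_M`.
* **K2(a)** (`hK2a`, the twisted constituent — an Euler-system UPPER bound, with the analytic CHOICE of `β`
  folded in as an existential): for `W`, `d`, `K`, `θ₁` as above there EXIST a totally positive `β ∈ K` of odd
  valuation above `3` and a model `Vβ ≅ (W_K)^{(β)}` with `L(Vβ/K, s)` entire, `#Ш_an(Vβ) = qβ ∈ ℚ`,
  `Ш(Vβ/K)[3^∞]` finite and `ord₃ #Ш(Vβ/K)[3^∞] ≤ ord₃ qβ` (Friedberg–Hoffstein over `K` + Kolyvagin /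
  Gross–Zagier–Zhang over the real quadratic `K`; by the parity remark of the companion file, `r_an(Vβ) = 0`
  is available only when `w(E/M) = −1` can be arranged, e.g. at a multiplicative prime `ℓ ≠ 3` of `E`;
  otherwise the bound is asked in rank one).
GIVEN these and the named facts `ArtinMilneShaDecomposition`, `exists_isNewformOf`,
`nonempty_modularParametrizationData`, `GrossZagier1986_thm_I_7_3`, `rank_eq_analyticRank_of_analyticRank_le_one`,
the registered stub statement holds verbatim (`stub_pairGivenGoodField_of_K1_of_K2a`). The glue: `K = ℚ(√d)`
(`exists_quadraticField_sq_eq_intCast`), `β` from K2(a), `M = K(√β)` (`exists_relQuadratic_sq_eq`; `β` is a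
non-square by its odd valuation at a place above `3`, which exists), `e(w ∣ 3) = 4`
(`ramificationIdx_int_eq_of_sq_eq`), `M` totally real (`isTotallyReal_of_sq_eq_of_totallyPositive`), good
reduction above `3` from the stub's LEVER hypothesis, `Wd ≅ W^{(d_K)}` (`exists_variableChange_quadraticTwist_discr`),
then `padicValRat_shaAn_pair_le_of_solventPackage`. BSD is not proved by any of this; no route file is imported.

References: J. S. Milne, Invent. Math. 17 (1972) Thm. 1; T. Dokchitser, V. Dokchitser, Ann. of Math. 172 (2010)
Thm. 2.3; S. Friedberg, J. Hoffstein, Ann. of Math. 142 (1995) Thm. B; R. L. Miller, LMS J. Comput. Math. 14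
(2011) Def. 1.1.
-/

-- D-0017: single-problem summit, so `Summit.BirchSwinnertonDyer.BirchSwinnertonDyer.…` repeats a namespace BY DESIGN.
set_option linter.dupNamespace false

noncomputable section

open scoped Classical NumberField

open IsDedekindDomain IsDedekindDomain.HeightOneSpectrum NumberField WithZero WeierstrassCurve
open Literature.NumberTheory.EllipticCurves
open Literature.NumberTheory.EllipticCurves.ModularForms
open Literature.NumberTheory.EllipticCurves.Rank1Residual
open Summit.BirchSwinnertonDyer.Rank1Residual.Additive

namespace Summit.BirchSwinnertonDyer.BirchSwinnertonDyer.Theorems.SolventPairLowerBound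

/-- **Stub `stub_pairGivenGoodField` from K1 and K2(a) alone** (plus the named facts `ArtinMilneShaDecomposition`,
modularity ×2, Gross–Zagier Thm. I.(7.3), Gross–Zagier–Kolyvagin). `hK1`: exact `BSD₃(W_M/M)` over every
totally real tame quartic `M = ℚ(√d)(√β)` (`β` totally positive of odd valuation above `3`, `e(w ∣ 3) = 4`, `W_M`
good above `3`). `hK2a`: for every `d > 0`, `3 ∥ d`, and `K = ℚ(√d)`, SOME such `β` whose twisted constituent
`E′ = (W_K)^{(β)}` has entire `L`-function, rational `#Ш_an`, finite `Ш[3^∞]` and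
`ord₃ #Ш(E′)[3^∞] ≤ ord₃ #Ш_an(E′)`. Conclusion: the registered stub statement, verbatim. The solvent field and
the Artin–Milne bookkeeping are discharged by the sibling rungs and the companion file; the parity constraint
on `β` (companion file, module docstring) is the K2(a) prover's business.
[cite: Milne1972ArithmeticAV, §1 Thm. 1] [cite: DokchitserDokchitserAnnals2010, §2.1 Thm. 2.3 and §4.2]
[cite: Miller2011LMS, §1 and Def. 1.1 (arXiv:1010.2431 p. 3)] -/
theorem stub_pairGivenGoodField_of_K1_of_K2a (hAM : ArtinMilneShaDecomposition)
    (hmod : exists_isNewformOf) (hmodP : nonempty_modularParametrizationData)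
    (hGZ : GrossZagier1986_thm_I_7_3) (hGZK : rank_eq_analyticRank_of_analyticRank_le_one)
    (hK1 : ∀ (W : WeierstrassCurve ℚ) [W.IsElliptic] [W.IsGloballyMinimal],
      ¬ W.HasCM → Addv W 3 → SubTprime W 3 → W.analyticRank = 1 →
      ∀ (d : ℤ), 0 < d → padicValInt 3 d = 1 →
      ∀ (K : Type) [Field K] [NumberField K] (θ₁ : K), Module.finrank ℚ K = 2 → θ₁ ^ 2 = (d : K) →
        θ₁ ∉ Set.range (algebraMap ℚ K) →
      ∀ (β : K), (∀ σ : K →+* ℝ, 0 < σ β) →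
        (∀ v : HeightOneSpectrum (𝓞 K), ((3 : ℕ) : 𝓞 K) ∈ v.asIdeal → ∃ k : ℤ, v.valuation K β = exp (2 * k + 1)) →
      ∀ (M : Type) [Field M] [NumberField M] [Algebra K M] (θ : M), Module.finrank K M = 2 →
        θ ^ 2 = algebraMap K M β → θ ∉ Set.range (algebraMap K M) → IsTotallyReal M →
        (∀ w : HeightOneSpectrum (𝓞 M), ((3 : ℕ) : 𝓞 M) ∈ w.asIdeal → w.asIdeal.ramificationIdx ℤ = 4) →
        (∀ w : HeightOneSpectrum (𝓞 M), ((3 : ℕ) : 𝓞 M) ∈ w.asIdeal → (W.baseChange M).HasGoodReductionAt w) →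
      ∀ (VM : WeierstrassCurve M) [VM.IsElliptic],
        (∃ C : WeierstrassCurve.VariableChange M, C • W.baseChange M = VM) → BSDpOver VM 3)
    (hK2a : ∀ (W : WeierstrassCurve ℚ) [W.IsElliptic] [W.IsGloballyMinimal],
      ¬ W.HasCM → Addv W 3 → SubTprime W 3 → W.analyticRank = 1 →
      ∀ (d : ℤ), 0 < d → padicValInt 3 d = 1 →
      ∀ (K : Type) [Field K] [NumberField K] (θ₁ : K), Module.finrank ℚ K = 2 → θ₁ ^ 2 = (d : K) →
        θ₁ ∉ Set.range (algebraMap ℚ K) →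
      ∃ (β : K) (Vβ : WeierstrassCurve K) (_ : Vβ.IsElliptic),
        (∀ σ : K →+* ℝ, 0 < σ β) ∧
        (∀ v : HeightOneSpectrum (𝓞 K), ((3 : ℕ) : 𝓞 K) ∈ v.asIdeal → ∃ k : ℤ, v.valuation K β = exp (2 * k + 1)) ∧
        (∃ C : WeierstrassCurve.VariableChange K, C • (W.baseChange K).quadraticTwist β = Vβ) ∧
        Vβ.HasEntireLFunction ∧
        ∃ qβ : ℚ, analyticSha Vβ = (qβ : ℂ) ∧ Finite (AddCommGroup.primaryComponent Vβ.sha 3) ∧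
          (padicValNat 3 (Nat.card (AddCommGroup.primaryComponent Vβ.sha 3)) : ℤ) ≤ padicValRat 3 qβ) :
    ∀ (W : WeierstrassCurve ℚ) [W.IsElliptic] [W.IsGloballyMinimal],
    ¬ W.HasCM → Addv W 3 → Summit.BirchSwinnertonDyer.Rank1Residual.Additive.SubTprime W 3 → W.analyticRank = 1 →
    (∀ (L : Type) [Field L] [NumberField L] (v : HeightOneSpectrum (𝓞 L)),
      ((3 : ℕ) : 𝓞 L) ∈ v.asIdeal → v.asIdeal.ramificationIdx ℤ = 4 →
      (W.baseChange L).HasGoodReductionAt v) →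
    ∀ (d : ℤ) (Wd : WeierstrassCurve ℚ) [Wd.IsElliptic] [Wd.IsGloballyMinimal],
      0 < d → padicValInt 3 d = 1 →
      (∃ C : WeierstrassCurve.VariableChange ℚ, C • W.quadraticTwist (d : ℚ) = Wd) →
      ¬ Wd.HasCM → Addv Wd 3 → Summit.BirchSwinnertonDyer.Rank1Residual.Additive.SubTprime Wd 3 → Wd.analyticRank = 0 →
      ∃ q q' : ℚ, shaAn W = (q : ℂ) ∧ shaAn Wd = (q' : ℂ) ∧
        padicValRat 3 q + padicValRat 3 q' ≤
          (padicValNat 3 W.shaOrder : ℤ) + (padicValNat 3 Wd.shaOrder : ℤ) := by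
  intro W _ _ hCM hadd hsub hr hgood d Wd _ _ hd hv htw hCMd haddd hsubd hr0
  haveI : Fact (Nat.Prime 3) := ⟨Nat.prime_three⟩
  -- `K = ℚ(√d)`
  obtain ⟨K, _, _, θ₁, h2, hθ₁, hθK⟩ :=
    exists_quadraticField_sq_eq_intCast (not_isSquare_ratCast_of_padicValInt_eq_one 3 hv)
  -- the analytic choice of `β` and the twisted constituent, from K2(a)
  obtain ⟨β, Vβ, _, hβpos, hβval, hVβ, hVβL, hK2a'⟩ := hK2a W hCM hadd hsub hr d hd hv K θ₁ h2 hθ₁ hθK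
  -- a place of `K` above `3` exists (`3` is not a unit of `𝓞 K`), so `β` is not a square
  obtain ⟨v₃, hv₃⟩ : ∃ v : HeightOneSpectrum (𝓞 K), ((3 : ℕ) : 𝓞 K) ∈ v.asIdeal := by
    have hnu : ¬ IsUnit (((3 : ℕ) : 𝓞 K)) := fun h ↦ by
      have h1 := h.map (Algebra.norm ℤ)
      rw [← map_natCast (algebraMap ℤ (𝓞 K)) 3, Algebra.norm_algebraMap, Int.isUnit_iff_natAbs_eq,
        Int.natAbs_pow, Int.natAbs_natCast] at h1
      exact (Nat.one_lt_pow (Module.finrank_pos (R := ℤ) (M := 𝓞 K)).ne' (by norm_num)).ne' h1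
    obtain ⟨𝔪, h𝔪, hle⟩ := Ideal.exists_le_maximal (Ideal.span {((3 : ℕ) : 𝓞 K)})
      (by rwa [Ne, Ideal.span_singleton_eq_top])
    refine ⟨⟨𝔪, h𝔪.isPrime, fun hbot ↦ ?_⟩, hle (Ideal.mem_span_singleton_self _)⟩
    have h := hle (Ideal.mem_span_singleton_self _)
    rw [hbot, Ideal.mem_bot] at h
    exact (Nat.cast_ne_zero.2 (by norm_num : (3 : ℕ) ≠ 0)) h
  obtain ⟨k, hk⟩ := hβval v₃ hv₃
  have hβnsq : ¬ IsSquare β := not_isSquare_of_valuation_eq_exp v₃ hk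
  -- `M = K(√β)`, totally real, with `e(w ∣ 3) = 4` and good reduction of `W` above `3` (the lever)
  obtain ⟨M, _, _, _, θ, h2', hθ, hθM⟩ := exists_relQuadratic_sq_eq hβnsq
  have he4 : ∀ w : HeightOneSpectrum (𝓞 M), ((3 : ℕ) : 𝓞 M) ∈ w.asIdeal → w.asIdeal.ramificationIdx ℤ = 4 := by
    intro w hw
    have h := ramificationIdx_int_eq_of_sq_eq (K := K) (M := M) 3 h2' hθ (e₀ := 2)
      (fun v hv' ↦ ⟨(ramificationIdx_eq_two_of_sq_eq_intCast 3 h2 hθ₁ hv v hv').1, hβval v hv'⟩) w hw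
    simpa using h
  have hgoodM : ∀ w : HeightOneSpectrum (𝓞 M), ((3 : ℕ) : 𝓞 M) ∈ w.asIdeal →
      (W.baseChange M).HasGoodReductionAt w := fun w hw ↦ hgood M w hw (he4 w hw)
  have hreal : IsTotallyReal M :=
    isTotallyReal_of_sq_eq_of_totallyPositive h2 hd.le hθ₁ hθK h2' hθ hθM hβpos
  -- K1 at this datum, on the model `W_M` itself
  have hK1' : BSDpOver (W.baseChange M) 3 :=
    hK1 W hCM hadd hsub hr d hd hv K θ₁ h2 hθ₁ hθK β hβpos hβval M θ h2' hθ hθM hreal he4 hgoodM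
      (W.baseChange M) ⟨1, one_smul _ _⟩
  -- the twist datum in the discriminant currency, then the Artin–Milne squeeze
  have hWd := exists_variableChange_quadraticTwist_discr h2 hθ₁ hθK W Wd htw
  exact padicValRat_shaAn_pair_le_of_solventPackage hAM hmod hmodP hGZ hGZK W hr Wd hr0 K h2 hWd M h2' hθ
    hθM Vβ hVβ (W.baseChange M) ⟨1, one_smul _ _⟩ hK1' hVβL hK2a'

end Summit.BirchSwinnertonDyer.BirchSwinnertonDyer.Theorems.SolventPairLowerBound

end
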